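import Literature.Topology.FourManifolds.ZeroSurgeryHomotopyBallSlice
import Literature.Topology.FourManifolds.SPC4Wave0
import HarnessLib

/-!
# Manolescu–Piccirillo Lemma 3.3 for `W = S⁴`: decomposition of the printed proof

Topic `Literature/Topology/FourManifolds`; fact item
`provefact-Literature.Knot.ManolescuPiccirillo2023_lemma33_sphere` for the named fact
`Literature.Topology.FourManifolds.Knot.ManolescuPiccirillo2023_lemma33_sphere` (`ZeroSurgeryHomotopyBallSlice.lean`):

> if `K, K' ⊂ S³` have a common `0`-surgery `Y` and `K` is smoothly slice, then `K'` bounds a smooth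
> proper disc in `Σ ∖ B̊⁴` for some closed smooth `4`-manifold `Σ ≃ S⁴`.

## Source and what it says (SIZE XL)

C. Manolescu, L. Piccirillo, *From zero surgeries to candidates for exotic definite 4-manifolds*,
J. Lond. Math. Soc. (2) 108 (2023) 2001–2036 = arXiv:2102.04391 (held as `paper:arxiv-2102.04391`;
page numbers below are those of the held 21-page text, §-numbers those of the paper).

* §1, p. 2: "If `K` is slice and `S³₀(K) ≅ S³₀(K')`, then by gluing the complement of the slice
  disk for `K` to the trace of the 0-surgery for `K'`, we obtain a homotopy 4-sphere `W`, such that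
  `K'` bounds a disk in `W ∖ B⁴`."
* §3.2, p. 6, **Lemma 3.3** ("folklore"; `W` smooth closed oriented simply connected,
  `φ : S³₀(K) → S³₀(K')` a homeomorphism, `K` H-slice in `W` ⇒ `K'` H-slice in some `X ≃ W`),
  **Definition 3.4** (the trace `X(K)`: `B⁴` with a `0`-framed `2`-handle attached along `K`) and
  the **proof of Lemma 3.3**: (i) `V := W° ∖ ν(Δ)` for a slice disc `Δ`; "It is routine to confirm
  that `∂V ≅ S³₀(K)` and that `π₁(V)` is normally generated by `ι_*(π₁(∂V))`"; (ii) `X := X(−K') ∪_φ V`;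
  "`X` has a handle diagram obtained from that of `V` by adding an additional 2-handle along the
  framed curve `φ(μ_{K'}, 0)`, followed by a 4-handle. As such" `π₁(X) = 1`; (iii) "It is routine to
  confirm that `X` has the homology type of `W`, and the intersection form on `H₂(X)` and `H₂(W)`
  coincide. It is then a consequence of Whitehead's Theorem (see [Milnor–Husemoller, p. 103,
  Thm. 1.5] or [Gompf–Stipsicz, Thm. 1.2.25]) that `X` is homotopy equivalent to `W`"; (iv) "`K' ⊂
  S³ ⊂ ∂(X°(−K'))` bounds a disk `D` in `X°(−K')` made up of the product cobordism in `S³ × I` and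
  the core of the 2-handle. This slice disk survives into `X`".

The vendored fact is the case `W = S⁴` (so `W° = B⁴`, "H-slice in `S⁴`" = slice, and the homology
condition in (iii) reads `H₂(X; ℤ) = 0`); it is NOT mis-stated (hypotheses: a common `0`-surgery
`Y` of `K` and `K'`, `K.IsSmoothlySlice`; conclusion `K'.IsHomotopyBallSlice`; orientations are
irrelevant for `W = S⁴`, see the docstring of the fact).

## Proof architecture (this file) — the DAG

Step (iii)'s appeal to Whitehead's theorem is, for `W = S⁴`, the tree's named fact
`Literature.Topology.FourManifolds.nonempty_homotopyEquiv_sphere_four_iff` (`SPC4Wave0.lean`; a closed topological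
`4`-manifold is `≃ S⁴` iff it is simply connected with `H₂ = 0`; Hurewicz + Whitehead + Poincaré
duality). The rest of the printed proof is recorded as three named facts, phrased WITHOUT a
theory of knot traces / manifolds with boundary, through the following observation: in
`X = X(K') ∪_Y V` the compact set `C := B⁴ ∪ D` (the `0`-handle together with the core disc of the
`2`-handle, i.e. the datum `(e, f)` of `Knot.IsSliceDiscIn K' X e f`) has regular neighbourhood
`B⁴ ∪ ν(D) = X(K')` (Definition 3.4), and its complement `X ∖ C` is the interior of `V` with an
open collar attached along part of `∂V`, hence diffeomorphic to `int V ≅ B̊⁴ ∖ Δ`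
(`Literature.sliceDiscExterior g`, an open subset of `ℝ⁴`). Conversely a closed `X` containing such a
`C` with `X ∖ C ≅ B̊⁴ ∖ Δ` is `X(K') ∪_{∂} V` (the framing of the `2`-handle is forced to be `0`
and `∂V ≅ S³₀(K')` by comparing the ends of `X ∖ C` and of `B̊⁴ ∖ Δ`). So "`X = X(K') ∪_Y V`" is
rendered as: `K'.IsSliceDiscIn X e f` together with a smooth open embedding
`j : B̊⁴ ∖ Δ ↪ X` with `range j = X ∖ (e(𝔻⁴) ∪ f(𝔻²))`.

* `CONSTR` = `Knot.ManolescuPiccirillo2023_lemma33_sphere_construction` (steps (i), (ii), (iv):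
  the smooth gluing; its own sub-results — the framing of `K` induced by a slice disc is `0`, the
  open trace as an open gluing `ℝ⁴ ∪ ℝ⁴` along a `0`-framed tubular neighbourhood, an end collar
  `Y × (0,1) ↪ B̊⁴ ∖ Δ`, Hausdorffness and compactness of the pushout (`GluingConstruction.lean`) —
  are left to the sessions attacking it);
* `PI1` = `Knot.simplyConnectedSpace_of_isSliceDiscIn_of_range_eq` (step (ii)⇒`π₁(X) = 1`:
  van Kampen for `X = N(C) ∪ (X ∖ C)`, `π₁(X(K')) = 1`, `π₁(V)` normally generated by `π₁(∂V)`);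
* `H2` = `Knot.isZero_singularHomologyZ_two_of_isSliceDiscIn_of_range_eq` (step (iii), homology:
  Mayer–Vietoris, `H_*(B⁴ ∖ Δ) ≅ H_*(S¹)`, `H₂(∂X(K')) ≅ H₂(X(K'))`, `H₁(∂V) ≅ H₁(V)`);
* `CORE` = `Knot.ManolescuPiccirillo2023_lemma33_sphere_core` (the printed proof minus Whitehead:
  a closed smooth simply connected `X` with `H₂(X; ℤ) = 0` in which `K'` bounds a proper disc).

Proved here: `CONSTR → PI1 → H2 → CORE` (`…_core_of_facts`), `CORE → S10 → target`
(`ManolescuPiccirillo2023_lemma33_sphere_of_core`) and their composite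
(`ManolescuPiccirillo2023_lemma33_sphere_of_facts`); and the unfolding
`FramedLink.isSurgery_single_iff : (single K m).IsSurgery IY Y ↔ IsIntegralSurgery IY Y K m`,
which puts the two hypotheses of the target in the form used by `DehnSurgery.lean` (the first
step of any proof of `CONSTR`). No declaration uses `sorry`; the four `def … : Prop` are named
facts (D-0014), all consumed at universe `0` (the target quantifies `Y : Type` and
`IsHomotopyBallSlice` produces `M : Type`).

## References

* C. Manolescu, L. Piccirillo, J. Lond. Math. Soc. 108 (2023), §1 p. 2, §3.2 Lemma 3.3,
  Definition 3.4 and proof [ManolescuPiccirillo2023].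
* A. Hatcher, *Algebraic Topology* (2002), Thm. 1.20 (van Kampen), Prop. 1.26 (attaching
  `2`-cells), §2.2 p. 149 (Mayer–Vietoris) [HatcherAT2002].
* R. C. Kirby, *The Topology of 4-Manifolds*, LNM 1374 (1989), Ch. I §§1–2 (handlebodies, the
  `2`-handlebody `B⁴ ∪ h²` of a framed knot; dotted-circle notation for `B⁴ ∖ ν(Δ)`) [Kirby1989].
* M. H. Freedman, F. Quinn, *Topology of 4-Manifolds* (1990), §10 [FreedmanQuinnPMS1990] (via
  `Literature.Topology.FourManifolds.nonempty_homotopyEquiv_sphere_four_iff`).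

## Design choices

* No new manifold is constructed and no trace vocabulary is introduced: the only definition is the
  open subset `Literature.sliceDiscExterior g = B̊⁴ ∖ closure (g(𝔻²)) ⊆ ℝ⁴` (for a slice disc `g` the
  closure is superfluous, `sliceDiscExterior_eq_of_continuous`), which carries Mathlib's
  open-submanifold structure (`TopologicalSpace.Opens.instChartedSpace`), exactly like
  `Literature.Topology.FourManifolds.SphereEmbedding.complement` and `Literature.Topology.FourManifolds.solidTorus`.
* `PI1` and `H2` quantify over ALL closed smooth `X` carrying `(e, f, j)` as above, with no
  hypothesis relating `K` and `K'`: both are true in that generality (the regular neighbourhood of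
  `e(𝔻⁴) ∪ f(𝔻²)` is `B⁴ ∪_{K'} h²` for some framing `n`; the end of `X ∖ C ≅ B̊⁴ ∖ Δ` forces
  `H₁(S³ₙ(K')) ≅ H₁(∂V) ≅ ℤ`, i.e. `n = 0`; then van Kampen / Mayer–Vietoris as in the source).
  They are stated universe-polymorphically in `X : Type u`, like `SPC4.nonempty_homotopyEquiv_sphere_four_iff`.
* `CONSTR` keeps the exact hypotheses of the target on `Y` (a bare `ChartedSpace (𝔼 3)`; the two
  `IsSurgery` hypotheses provide the smooth open embeddings of `S³ ∖ K`, `S³ ∖ K'` and of the two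
  surgery solid tori that the gluing uses) and takes the slice disc `g` as data, since the
  exterior `B̊⁴ ∖ g(𝔻²)` depends on it.
-/

open scoped Manifold ContDiff Topology
open Function Set ContinuousMap CategoryTheory

noncomputable section

namespace Literature.Topology.FourManifolds

universe u

/-- Local notation: `𝔼 n` is the model Euclidean space `EuclideanSpace ℝ (Fin n)`. -/
local notation "𝔼 " n:arg => EuclideanSpace ℝ (Fin n)

/-- Local notation: `𝕊 n` is the unit sphere in `EuclideanSpace ℝ (Fin (n + 1))`. -/
local notation "𝕊 " n:arg => (Metric.sphere (0 : EuclideanSpace ℝ (Fin (n + 1))) 1)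

/-- Local notation: `𝔻²` is the closed unit disc in `ℝ²`. -/
local notation "𝔻²" => Metric.closedBall (0 : EuclideanSpace ℝ (Fin 2)) 1

/-! ### The open slice-disc exterior `B̊⁴ ∖ Δ` -/

/-- The **open slice-disc exterior** of a disc `g : ℝ² → ℝ⁴` (meant: `Knot.IsSliceDisc K g`): the
open subset `B̊⁴ ∖ g(𝔻²)` of `ℝ⁴` (we remove the closure of `g(𝔻²)`, which for continuous `g` is
`g(𝔻²)` itself, so that the set is open for every `g`). For a slice disc `Δ = g(𝔻²) ⊂ B⁴` this is
the interior of the slice-disc exterior `V = B⁴ ∖ ν(Δ)` of Manolescu–Piccirillo (up to the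
diffeomorphism absorbing the open collar `ν(Δ) ∖ Δ`), an open `4`-manifold whose end is
`∂V × (0,1) = S³₀(K) × (0,1)`. It carries Mathlib's open-submanifold structure.
[cite: ManolescuPiccirillo2023, §3.2, proof of Lemma 3.3] -/
def sliceDiscExterior (g : 𝔼 2 → 𝔼 4) : TopologicalSpace.Opens (𝔼 4) :=
  ⟨Metric.ball (0 : 𝔼 4) 1 \ closure (g '' 𝔻²), Metric.isOpen_ball.sdiff isClosed_closure⟩

/-- Unfolding of `sliceDiscExterior`. [folklore] -/
@[simp]
theorem mem_sliceDiscExterior_iff {g : 𝔼 2 → 𝔼 4} {x : 𝔼 4} :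
    x ∈ sliceDiscExterior g ↔ ‖x‖ < 1 ∧ x ∉ closure (g '' 𝔻²) := by
  simp [sliceDiscExterior, ← SetLike.mem_coe]

/-- The carrier of `sliceDiscExterior g`. [folklore] -/
theorem coe_sliceDiscExterior (g : 𝔼 2 → 𝔼 4) :
    (sliceDiscExterior g : Set (𝔼 4)) = Metric.ball (0 : 𝔼 4) 1 \ closure (g '' 𝔻²) := rfl

/-- For continuous `g` (e.g. a slice disc) the removed set is `g(𝔻²)` itself, a compact set. [folklore] -/
theorem coe_sliceDiscExterior_of_continuous {g : 𝔼 2 → 𝔼 4} (hg : Continuous g) :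
    (sliceDiscExterior g : Set (𝔼 4)) = Metric.ball (0 : 𝔼 4) 1 \ g '' 𝔻² := by
  rw [coe_sliceDiscExterior, ((isCompact_closedBall (0 : 𝔼 2) 1).image hg).isClosed.closure_eq]

/-- The open slice-disc exterior lies in the open unit ball. [folklore] -/
theorem sliceDiscExterior_subset_ball (g : 𝔼 2 → 𝔼 4) :
    (sliceDiscExterior g : Set (𝔼 4)) ⊆ Metric.ball (0 : 𝔼 4) 1 :=
  fun _ hx ↦ hx.1

/-- The open slice-disc exterior misses the disc. [folklore] -/
theorem disjoint_sliceDiscExterior_image (g : 𝔼 2 → 𝔼 4) :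
    Disjoint (sliceDiscExterior g : Set (𝔼 4)) (g '' 𝔻²) :=
  disjoint_sdiff_left.mono_right subset_closure

/-! ### Unfolding the hypotheses: surgery on `FramedLink.single K m` is `m`-surgery on `K` -/

namespace FramedLink

/-- The complement of the one-component framed link `(K, m)` is the knot complement. [folklore] -/
@[simp]
theorem complement_toLink_single (K : Knot) (m : ℤ) :
    (single K m).toLink.complement = K.complement := by
  ext x
  simp [single]

variable {EY HY : Type*} [NormedAddCommGroup EY] [NormedSpace ℝ EY] [TopologicalSpace HY]
  {IY : ModelWithCorners ℝ EY HY} {Y : Type*} [TopologicalSpace Y] [ChartedSpace HY Y]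

/-- **Surgery on the one-component framed link `(K, m)` is `m`-surgery on the knot `K`** (and
conversely): both are the open gluing of the knot complement and one open solid torus along
`surgeryRel ν` for a tubular neighbourhood `ν` of framing `m`; over the index type `Fin 1` the
pairwise disjointness conditions of `IsIntegralSurgeryLink` are vacuous and the union over the
components is the single solid torus. This converts the hypotheses of
`Knot.ManolescuPiccirillo2023_lemma33_sphere` into the form `Literature.IsIntegralSurgery (𝓡 3) Y K 0`
of `DehnSurgery.lean` (companion of `IsIntegralSurgery.isIntegralSurgeryLink_holds`, which treats
`Link.ofKnot`). Gompf–Stipsicz (1999), §5.3; Rolfsen (1976), §9.F. [cite: GompfStipsicz1999, §5.3] -/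
theorem isSurgery_single_iff (K : Knot) (m : ℤ) :
    (single K m).IsSurgery IY Y ↔ IsIntegralSurgery IY Y K m := by
  -- Transport along the equality of open sets `(single K m).toLink.complement = K.complement`,
  -- generalising the open set of the link side as in `IsIntegralSurgery.isIntegralSurgeryLink'`.
  suffices key : ∀ U : TopologicalSpace.Opens (𝕊 3), U = K.complement →
      ((∃ ν : ∀ _ : Fin 1, Knot.TubularNbhd K, (∀ i, (ν i).HasFraming m) ∧
        (Pairwise fun i j ↦ Disjoint (range (ν i)) (range (ν j))) ∧
        ∃ (jA : U → Y) (jB : Fin 1 → solidTorus → Y),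
          Manifold.IsSmoothEmbedding (𝓡 3) IY ∞ jA ∧ IsOpen (range jA) ∧
          (∀ i, Manifold.IsSmoothEmbedding (𝓘(ℝ, 𝔼 2).prod (𝓡 1)) IY ∞ (jB i) ∧
            IsOpen (range (jB i))) ∧
          range jA ∪ (⋃ i, range (jB i)) = univ ∧
          (Pairwise fun i j ↦ Disjoint (range (jB i)) (range (jB j))) ∧
          ∀ i (a : U) b, jA a = jB i b ↔
            (ν i).glueRel (a : 𝕊 3) (b : (𝔼 2) × (𝕊 1))) ↔
      IsIntegralSurgery IY Y K m) from
    key _ (complement_toLink_single K m)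
  rintro U rfl
  constructor
  · rintro ⟨ν, hν, -, jA, jB, hA, hAo, hB, hU, -, hR⟩
    refine ⟨ν 0, hν 0, jA, jB 0, hA, hAo, (hB 0).1, (hB 0).2, ?_, fun a b ↦ hR 0 a b⟩
    have h1 : (⋃ i : Fin 1, range (jB i)) = range (jB 0) := by
      ext x
      simp only [mem_iUnion, Fin.exists_fin_one]
    rwa [h1] at hU
  · rintro ⟨ν, hν, jA, jB, hA, hAo, hB, hBo, hU, hR⟩
    refine ⟨fun _ ↦ ν, fun _ ↦ hν, fun i j hij ↦ absurd (Subsingleton.elim i j) hij, jA,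
      fun _ ↦ jB, hA, hAo, fun _ ↦ ⟨hB, hBo⟩, ?_,
      fun i j hij ↦ absurd (Subsingleton.elim i j) hij, fun _ a b ↦ hR a b⟩
    rwa [iUnion_const]

/-- In particular the two hypotheses of `Knot.ManolescuPiccirillo2023_lemma33_sphere` say that `Y`
is `0`-surgery on `K` and on `K'` in the sense of `Literature.Topology.FourManifolds.IsIntegralSurgery`. [folklore] -/
theorem IsSurgery.isIntegralSurgery {K : Knot} {m : ℤ} (h : (single K m).IsSurgery IY Y) :
    IsIntegralSurgery IY Y K m :=
  (isSurgery_single_iff K m).1 h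

end FramedLink

namespace Knot

/-! ### The three leaves of the printed proof (named facts, D-0014) -/

/-- **Manolescu–Piccirillo, proof of Lemma 3.3 for `W = S⁴`, construction step** (steps (i), (ii),
(iv) of the module docstring). Let `K, K'` be knots with a common `0`-surgery `Y` and let `g` be
a slice disc for `K` in `B⁴` (`Δ := g(𝔻²)`). Then there is a closed smooth `4`-manifold `X` —
namely `X = X(K') ∪_Y V`, the `0`-trace of `K'` glued along `∂X(K') = S³₀(K') ≅ Y ≅ S³₀(K) = ∂V`
to the slice-disc exterior `V = B⁴ ∖ ν(Δ)` — together with a smooth ball `e : ℝ⁴ ↪ X` (the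
`0`-handle of the trace) and a smooth proper disc `f` for `K'` in `X ∖ e(B̊⁴)` (the core of the
`2`-handle: `K'.IsSliceDiscIn X e f`), such that the complement of `C := e(𝔻⁴) ∪ f(𝔻²)` is the
image of a smooth open embedding `j` of `B̊⁴ ∖ Δ` (the interior of `V`, the open collar
`X(K') ∖ C ≅ (∂V-part) × [0,1)` being absorbed into `int V`). Ingredients of the printed "routine"
verification `∂V ≅ S³₀(K)`: the framing of `K` induced by the normal bundle of `Δ` is the
`0`-framing. [cite: ManolescuPiccirillo2023, §3.2, proof of Lemma 3.3 and Definition 3.4]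
[cite: Kirby1989, Ch. I §§1–2] -/
def ManolescuPiccirillo2023_lemma33_sphere_construction : Prop :=
  ∀ (K K' : Knot) (Y : Type) [TopologicalSpace Y] [ChartedSpace (𝔼 3) Y],
    (FramedLink.single K 0).IsSurgery (𝓡 3) Y → (FramedLink.single K' 0).IsSurgery (𝓡 3) Y →
    ∀ g : 𝔼 2 → 𝔼 4, K.IsSliceDisc g →
      ∃ (X : Type) (_ : TopologicalSpace X) (_ : T2Space X) (_ : SecondCountableTopology X)
        (_ : ChartedSpace (𝔼 4) X) (_ : IsManifold (𝓡 4) ∞ X) (_ : CompactSpace X)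
        (e : 𝔼 4 → X) (f : 𝔼 2 → X) (j : sliceDiscExterior g → X),
        K'.IsSliceDiscIn X e f ∧ Manifold.IsSmoothEmbedding (𝓡 4) (𝓡 4) ∞ j ∧
          range j = (e '' Metric.closedBall (0 : 𝔼 4) 1 ∪ f '' 𝔻²)ᶜ

/-- **Manolescu–Piccirillo, proof of Lemma 3.3 for `W = S⁴`, fundamental group** ("`X` has a
handle diagram obtained from that of `V` by adding an additional 2-handle along `φ(μ_{K'}, 0)`,
followed by a 4-handle. As such `π₁(X) = 1`"). In the complement form: let `X` be a closed smooth
`4`-manifold, `f` a smooth proper disc for `K'` in `X ∖ e(B̊⁴)` and `j : B̊⁴ ∖ Δ ↪ X` a smooth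
embedding onto `X ∖ (e(𝔻⁴) ∪ f(𝔻²))`, `Δ = g(𝔻²)` a slice disc of some knot `K`; then `X` is
simply connected. (Van Kampen for `X = N ∪ (X ∖ C)`, `N = e(B⁴) ∪ ν(f 𝔻²) = B⁴ ∪_{K'} h²` simply
connected by Hatcher Prop. 1.26; `π₁(X ∖ C) = π₁(B⁴ ∖ Δ)` is normally generated by the image of
the fundamental group of its end `∂V × (0,1)`, because `B⁴ = V ∪ (2-handle along a meridian of Δ)`
is simply connected.) [cite: ManolescuPiccirillo2023, §3.2, proof of Lemma 3.3]
[cite: HatcherAT2002, Thm. 1.20 and Prop. 1.26] -/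
def simplyConnectedSpace_of_isSliceDiscIn_of_range_eq : Prop :=
  ∀ (K K' : Knot) (g : 𝔼 2 → 𝔼 4) (_ : K.IsSliceDisc g) (X : Type u) [TopologicalSpace X]
    [T2Space X] [SecondCountableTopology X] [ChartedSpace (𝔼 4) X] [IsManifold (𝓡 4) ∞ X]
    [CompactSpace X] (e : 𝔼 4 → X) (f : 𝔼 2 → X) (j : sliceDiscExterior g → X),
    K'.IsSliceDiscIn X e f → Manifold.IsSmoothEmbedding (𝓡 4) (𝓡 4) ∞ j →
      range j = (e '' Metric.closedBall (0 : 𝔼 4) 1 ∪ f '' 𝔻²)ᶜ → SimplyConnectedSpace X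

/-- **Manolescu–Piccirillo, proof of Lemma 3.3 for `W = S⁴`, homology** ("It is routine to
confirm that `X` has the homology type of `W`"; for `W = S⁴`: `H₂(X; ℤ) = 0`, the input of
`SPC4.nonempty_homotopyEquiv_sphere_four_iff`). In the complement form of
`simplyConnectedSpace_of_isSliceDiscIn_of_range_eq`: such an `X` has `H₂(X; ℤ) = 0`.
(Mayer–Vietoris for `X = N ∪ (X ∖ C)` with `N ≅ X(K')`, `X ∖ C ≅ int V`, `N ∩ (X ∖ C) ≃ ∂V`:
`H_*(V) ≅ H_*(B⁴ ∖ Δ) ≅ H_*(S¹)`, `H₁(∂V) → H₁(V)` and `H₂(∂X(K')) → H₂(X(K')) ≅ ℤ` are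
isomorphisms, `H₁(X(K')) = 0`.) [cite: ManolescuPiccirillo2023, §3.2, proof of Lemma 3.3]
[cite: HatcherAT2002, §2.2 p. 149 (Mayer–Vietoris)] -/
def isZero_singularHomologyZ_two_of_isSliceDiscIn_of_range_eq : Prop :=
  ∀ (K K' : Knot) (g : 𝔼 2 → 𝔼 4) (_ : K.IsSliceDisc g) (X : Type u) [TopologicalSpace X]
    [T2Space X] [SecondCountableTopology X] [ChartedSpace (𝔼 4) X] [IsManifold (𝓡 4) ∞ X]
    [CompactSpace X] (e : 𝔼 4 → X) (f : 𝔼 2 → X) (j : sliceDiscExterior g → X),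
    K'.IsSliceDiscIn X e f → Manifold.IsSmoothEmbedding (𝓡 4) (𝓡 4) ∞ j →
      range j = (e '' Metric.closedBall (0 : 𝔼 4) 1 ∪ f '' 𝔻²)ᶜ →
        Limits.IsZero (FourManifolds.singularHomologyZ X 2)

/-- **Manolescu–Piccirillo, proof of Lemma 3.3 for `W = S⁴`, everything but Whitehead's
theorem**: if `K, K'` have a common `0`-surgery and `K` is smoothly slice, then there is a closed
smooth `4`-manifold `X` (namely `X(K') ∪_Y V`) which is simply connected, has `H₂(X; ℤ) = 0`,
and in which `K'` bounds a smooth proper disc off a ball. The source concludes from here by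
Whitehead's theorem [Milnor–Husemoller Thm. 1.5; Gompf–Stipsicz Thm. 1.2.25], in the tree
`SPC4.nonempty_homotopyEquiv_sphere_four_iff`; see `ManolescuPiccirillo2023_lemma33_sphere_of_core`.
[cite: ManolescuPiccirillo2023, §3.2, proof of Lemma 3.3] -/
def ManolescuPiccirillo2023_lemma33_sphere_core : Prop :=
  ∀ (K K' : Knot) (Y : Type) [TopologicalSpace Y] [ChartedSpace (𝔼 3) Y],
    (FramedLink.single K 0).IsSurgery (𝓡 3) Y → (FramedLink.single K' 0).IsSurgery (𝓡 3) Y →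
      K.IsSmoothlySlice →
      ∃ (X : Type) (_ : TopologicalSpace X) (_ : T2Space X) (_ : SecondCountableTopology X)
        (_ : ChartedSpace (𝔼 4) X) (_ : IsManifold (𝓡 4) ∞ X) (_ : CompactSpace X),
        SimplyConnectedSpace X ∧ Limits.IsZero (FourManifolds.singularHomologyZ X 2) ∧
          ∃ (e : 𝔼 4 → X) (f : 𝔼 2 → X), K'.IsSliceDiscIn X e f

/-! ### Assembly (proved) -/

/-- **Assembly of the three leaves**: the construction, the fundamental-group computation and the
homology computation give the Whitehead-free core of the printed proof.
[cite: ManolescuPiccirillo2023, §3.2, proof of Lemma 3.3] -/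
theorem ManolescuPiccirillo2023_lemma33_sphere_core_of_facts
    (hC : ManolescuPiccirillo2023_lemma33_sphere_construction)
    (hπ : simplyConnectedSpace_of_isSliceDiscIn_of_range_eq.{0})
    (hH : isZero_singularHomologyZ_two_of_isSliceDiscIn_of_range_eq.{0}) :
    ManolescuPiccirillo2023_lemma33_sphere_core := by
  intro K K' Y _ _ hK hK' hslice
  obtain ⟨g, hg⟩ := hslice
  obtain ⟨X, _, _, _, _, _, _, e, f, j, hef, hj, hrange⟩ := hC K K' Y hK hK' g hg
  exact ⟨X, _, ‹_›, ‹_›, _, ‹_›, ‹_›, hπ K K' g hg X e f j hef hj hrange,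
    hH K K' g hg X e f j hef hj hrange, e, f, hef⟩

/-- **Whitehead step** (MP: "It is then a consequence of Whitehead's Theorem … that `X` is
homotopy equivalent to `W`"): the core of the printed proof together with the characterisation
of homotopy `4`-spheres by `π₁ = 1`, `H₂ = 0` (`SPC4.nonempty_homotopyEquiv_sphere_four_iff`)
gives the vendored fact. [cite: ManolescuPiccirillo2023, §3.2, proof of Lemma 3.3] -/
theorem ManolescuPiccirillo2023_lemma33_sphere_of_core
    (hcore : ManolescuPiccirillo2023_lemma33_sphere_core)
    (hS10 : FourManifolds.nonempty_homotopyEquiv_sphere_four_iff.{0}) :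
    ManolescuPiccirillo2023_lemma33_sphere := by
  intro K K' Y _ _ hK hK' hslice
  obtain ⟨X, _, _, _, _, _, _, hπ, hH, e, f, hef⟩ := hcore K K' Y hK hK' hslice
  exact hef.isHomotopyBallSlice ((hS10 X).2 ⟨hπ, hH⟩)

/-- **The whole DAG at once**: `CONSTR → PI1 → H2 → S10 → ManolescuPiccirillo2023_lemma33_sphere`.
[cite: ManolescuPiccirillo2023, §3.2, Lemma 3.3] -/
theorem ManolescuPiccirillo2023_lemma33_sphere_of_facts
    (hC : ManolescuPiccirillo2023_lemma33_sphere_construction)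
    (hπ : simplyConnectedSpace_of_isSliceDiscIn_of_range_eq.{0})
    (hH : isZero_singularHomologyZ_two_of_isSliceDiscIn_of_range_eq.{0})
    (hS10 : FourManifolds.nonempty_homotopyEquiv_sphere_four_iff.{0}) :
    ManolescuPiccirillo2023_lemma33_sphere :=
  ManolescuPiccirillo2023_lemma33_sphere_of_core
    (ManolescuPiccirillo2023_lemma33_sphere_core_of_facts hC hπ hH) hS10

/-- Consequently, under the same four facts, the Manolescu–Piccirillo strategy statement
`ManolescuPiccirillo2023_lemma33_sphere.exists_exotic` needs only the FGMW lemma (proved in the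
tree, `HomotopyBallSliceProofs.lean`) as further input. [cite: ManolescuPiccirillo2023, §1 p. 2] -/
theorem exists_isHomotopyBallSlice_not_isSmoothlySlice_of_facts
    (hC : ManolescuPiccirillo2023_lemma33_sphere_construction)
    (hπ : simplyConnectedSpace_of_isSliceDiscIn_of_range_eq.{0})
    (hH : isZero_singularHomologyZ_two_of_isSliceDiscIn_of_range_eq.{0})
    (hS10 : FourManifolds.nonempty_homotopyEquiv_sphere_four_iff.{0})
    (h : ∃ (K K' : Knot) (Y : Type) (_ : TopologicalSpace Y)
      (_ : ChartedSpace (𝔼 3) Y),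
      (FramedLink.single K 0).IsSurgery (𝓡 3) Y ∧ (FramedLink.single K' 0).IsSurgery (𝓡 3) Y ∧
        K.IsSmoothlySlice ∧ ¬ K'.IsSmoothlySlice) :
    ∃ K : Knot, K.IsHomotopyBallSlice ∧ ¬ K.IsSmoothlySlice :=
  (ManolescuPiccirillo2023_lemma33_sphere_of_facts hC hπ hH
    hS10).exists_isHomotopyBallSlice_not_isSmoothlySlice h

end Knot

end Literature.Topology.FourManifolds

end
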